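import Literature.AlgebraicGeometry.Resolution.RegularCentreRsopPart
import Literature.AlgebraicGeometry.Resolution.InitialFormsAlongCentre
import Literature.AlgebraicGeometry.Resolution.HironakaTauScheme
import HarnessLib

/-!
# `τ(x)` maximal forces the permissible centre through `x` to be the point (CoP1, Lemma 4.3 (1))

Topic: `Literature/AlgebraicGeometry/Resolution`. [CoP1] = Cossart–Piltant, J. Algebra 320
(2008), Lemma 4.3 (1), p. 8: "If `τ(x) = 3`, then `Y = {x}` …", where `Y = V(y_1, …, y_r)` is a
centre permissible for `E = (J, μ)` at the point `x` of the regular threefold `X`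
(`Y ⊆ Σ = {ord = μ}` regular, `(y_1, …, y_r)` part of a regular system of parameters of
`𝒪_{X,x}`), and `τ(x) = dim_{k(x)} T_x` is the dimension of the directrix of `cl_μ J_x`; the
first assertion is "(10): `in_x f ∈ k(x)[Y_1, …, Y_r]`", so `T_x ⊆ ⟨Y_1, …, Y_r⟩` and
`τ(x) ≤ r`. PROVED for a regular centre in a regular locally Noetherian scheme of any
dimension, with `3` replaced by the embedding dimension of `𝒪_{X,x}`
(`InitialFormsAlongCentre.lean` for the algebra, `RegularCentreRsopPart.lean` for
"`Y = V(y_1, …, y_r)`"):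

* `stalkTau_le_of_isRsopPart` — **`τ(x) ≤ r`** for a permissible centre cut out at `x` by `r`
  regular parameters;
* `stalkIdeal_vanishingIdeal_eq_maximalIdeal_of_stalkTau_eq` — **Lemma 4.3 (1), first
  assertion: if `τ(x) = emb.dim 𝒪_{X,x}` then `𝓘_{Y,x} = 𝔪_{X,x}`, i.e. `Y` is the reduced
  point `x` near `x`.**

(The second assertion of Lemma 4.3 (1), "no point of `q⁻¹(x)` is near `x`", is Hironaka's
theorem on the directrix and is not treated here.)

## Sources

* V. Cossart, O. Piltant, J. Algebra 320 (2008) 1051–1082, Lemma 4.3 (1) and (10), p. 8.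
  [CossartPiltant2008]
-/

noncomputable section

open CategoryTheory AlgebraicGeometry TopologicalSpace IsLocalRing

namespace Literature.AlgebraicGeometry.Resolution

universe u

open Scheme.IdealSheafData

variable {X : Scheme.{u}} [IsLocallyNoetherian X]

/-- The image of the first block of indices under a full regular system of parameters
extending `c` is the range of `c`. [folklore] -/
theorem image_coe_image_castAdd_eq_range {R : Type u} {r e : ℕ} (x : Fin (r + e) → R)
    (c : Fin r → R) (hxc : ∀ i, x (Fin.castAdd e i) = c i) :
    x '' ((Finset.univ.image (Fin.castAdd e) : Finset (Fin (r + e))) : Set (Fin (r + e))) =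
      Set.range c := by
  rw [Finset.coe_image, Finset.coe_univ, Set.image_univ, ← Set.range_comp]
  exact congrArg Set.range (funext hxc)

/-- **`τ(x) ≤ r` along a permissible centre** ([CoP1] (10): `T_x ⊆ ⟨Y_1, …, Y_r⟩`): if the
regular centre `Y ⊆ {ord = μ}` of the regular locally Noetherian `X` is cut out at `x ∈ Y` by
`r` members `c` of a regular system of parameters, then `τ(x) ≤ r`.
[cite: CossartPiltant2008, proof of Prop. 4.2, (10)] -/
theorem stalkTau_le_of_isRsopPart (hX : Scheme.IsRegular X) {Y : Closeds X}
    (hreg : Scheme.IsRegular (vanishingIdeal Y).subscheme) {J : X.IdealSheafData} {μ : ℕ}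
    (hY : ∀ y ∈ (Y : Set X), idealOrder J y = μ) {x : X} [IsRegularLocalRing (X.presheaf.stalk x)]
    {r : ℕ} {c : Fin r → X.presheaf.stalk x} (hcr : IsRsopPart c)
    (hcY : Ideal.span (Set.range c) = stalkIdeal (vanishingIdeal Y) x) :
    stalkTau J x μ ≤ r := by
  classical
  obtain ⟨e, x', hd, hx', hx'c⟩ := hcr.exists_rsop
  rw [stalkTau_eq J x μ hd x' hx']
  have hJ : stalkIdeal J x ≤ Ideal.span (x' '' ((Finset.univ.image (Fin.castAdd e) :
      Finset (Fin (r + e))) : Set (Fin (r + e)))) ^ μ := by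
    rw [image_coe_image_castAdd_eq_range x' c hx'c, hcY, ← stalkIdeal_pow]
    exact stalkIdeal_mono (le_vanishingIdeal_pow_of_forall_idealOrder_eq hX hreg hY) _
  refine (hironakaTauAt_le_card hd x' hx' _ hJ).trans ?_
  exact Finset.card_image_le.trans (by rw [Finset.card_univ, Fintype.card_fin])

/-- **[CoP1] Lemma 4.3 (1), first assertion: "If `τ(x) = 3`, then `Y = {x}`."** For a regular
centre `Y ⊆ {ord = μ}` of the regular locally Noetherian `X` through `x`: if `τ(x)` equals the
embedding dimension of `𝒪_{X,x}`, then the ideal of `Y` at `x` is the maximal ideal (so `Y` is,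
near `x`, the reduced point `x`). [cite: CossartPiltant2008, Lemma 4.3 (1)] -/
theorem stalkIdeal_vanishingIdeal_eq_maximalIdeal_of_stalkTau_eq (hX : Scheme.IsRegular X)
    {Y : Closeds X} (hreg : Scheme.IsRegular (vanishingIdeal Y).subscheme)
    {J : X.IdealSheafData} {μ : ℕ} (hY : ∀ y ∈ (Y : Set X), idealOrder J y = μ) {x : X}
    [IsRegularLocalRing (X.presheaf.stalk x)] (hx : x ∈ (Y : Set X))
    (hτ : stalkTau J x μ = (maximalIdeal (X.presheaf.stalk x)).spanFinrank) :
    stalkIdeal (vanishingIdeal Y) x = maximalIdeal (X.presheaf.stalk x) := by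
  classical
  obtain ⟨r, c, hcr, hcY⟩ := exists_isRsopPart_span_range_eq_stalkIdeal_of_mem_closeds hreg hx
  obtain ⟨e, x', hd, hx', hx'c⟩ := hcr.exists_rsop
  rw [stalkTau_eq J x μ hd x' hx', hd] at hτ
  have hJ : stalkIdeal J x ≤ Ideal.span (x' '' ((Finset.univ.image (Fin.castAdd e) :
      Finset (Fin (r + e))) : Set (Fin (r + e)))) ^ μ := by
    rw [image_coe_image_castAdd_eq_range x' c hx'c, hcY, ← stalkIdeal_pow]
    exact stalkIdeal_mono (le_vanishingIdeal_pow_of_forall_idealOrder_eq hX hreg hY) _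
  have h := span_image_eq_maximalIdeal_of_hironakaTauAt_eq hd x' hx' _ hJ hτ
  rwa [image_coe_image_castAdd_eq_range x' c hx'c, hcY] at h

/-- Contrapositive, the form used in the algorithm: **along a permissible centre that is not the
point `x` itself (its ideal at `x` is not `𝔪_x`, e.g. a curve through `x`), `τ(x) < emb.dim`.**
[cite: CossartPiltant2008, Lemma 4.3 (1)] -/
theorem stalkTau_lt_spanFinrank_of_stalkIdeal_ne (hX : Scheme.IsRegular X)
    {Y : Closeds X} (hreg : Scheme.IsRegular (vanishingIdeal Y).subscheme)
    {J : X.IdealSheafData} {μ : ℕ} (hY : ∀ y ∈ (Y : Set X), idealOrder J y = μ) {x : X}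
    [IsRegularLocalRing (X.presheaf.stalk x)] (hx : x ∈ (Y : Set X))
    (hne : stalkIdeal (vanishingIdeal Y) x ≠ maximalIdeal (X.presheaf.stalk x)) :
    stalkTau J x μ < (maximalIdeal (X.presheaf.stalk x)).spanFinrank :=
  lt_of_le_of_ne (stalkTau_le J x μ) fun h =>
    hne (stalkIdeal_vanishingIdeal_eq_maximalIdeal_of_stalkTau_eq hX hreg hY hx h)

end Literature.AlgebraicGeometry.Resolution

end
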